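import Summits.PneNP.PneNP.Theorems.KarlinRubinMonotoneSufficesRoomCircuit
import Summits.PneNP.PneNP.Theorems.KarlinRubinMonotoneSufficesRoomParamsSize
import Summits.PneNP.PneNP.Theorems.KarlinRubinMonotoneSufficesRoomBase
import Summits.PneNP.PneNP.Theorems.KarlinRubinMonotoneBlindDnfPlanted
import Summits.PneNP.PneNP.Theses.KarlinRubin

/-!
# Crux `MonotoneSuffices` (stmt-PneNP-18026), the ROOM theorem — part 5: assembly

**The room theorem** (`karlinRubin_exists_monotone_detector_quasipoly`): for every `δ ∈ (0,1/2)` and every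
`ε > 0` there is a family of MONOTONE circuits over `{∧₂, ∨₂, 0, 1}` on the edges of `Kₙ`, of size
`≤ n^{(2δ+ε) log₂ n}` eventually, whose `G(n,1/2)`-acceptance probability plus planted-`⌈n^{1/2-δ}⌉`-clique
rejection probability tends to `0`. The family is the guess-and-verify detector
`D x = [∃ T, #T = t, θ ≤ #{u ∉ T : u ~ T}]` with `2^t ≈ 800 n (log₂ n + 1)²/k²` (`= n^{2δ+o(1)}`) and
`θ = (n-t)/2^t + k/4 + 1` (parts 1–4: Chernoff tails for the binomial common-neighbourhood counts, the
monotone circuit, the parameter bookkeeping).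

This calibrates both cruxes of route KarlinRubin: it is the upper bound `n^{(2δ+o(1)) log₂ n}` quoted WITHOUT
proof in the rationale of `MonotoneBlind` ("the truth is conjecturally `n^{Θ(δ log n)}`") — so no monotone lower
bound beyond `2^{(2δ+o(1)) log₂² n}` can hold — and it sharpens the lower slice of the `MonotoneSuffices`
sandwich (`karlinRubin_monotoneSuffices_of_quasipolyHard`, exponent `a = 4c` from the brute-force
`n^{3 log₂ n + 5}` detector) to `karlinRubin_monotoneSuffices_of_quasipolyHard_real`: ANY quasi-polynomial
nonuniform lower bound `size ≥ n^{η log₂ n}` for strongly detecting `B₂` families gives `MonotoneSuffices`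
at `δ` with `a = ⌈3δ/η⌉ + 1`.
-/

set_option linter.dupNamespace false -- `Summit.PneNP.PneNP.…`: summit = sub-problem name (D-0017 single-conjunct layout)

namespace Summit.PneNP.PneNP.Theorems

open Filter Topology Finset Real
open scoped ENNReal
open Literature.Computability.Complexity
open Literature.Probability.RandomGraphs.PlantedClique
open Summit.PneNP.PneNP.Theorems.MonotoneSuffices.Room

/-! ### The vanishing bound -/

/-- `2 e^{-(⌊log₂ n⌋ + 1)} → 0` in `ℝ≥0∞`. [folklore] -/
theorem tendsto_ofReal_two_mul_exp_neg :
    Tendsto (fun n : ℕ => ENNReal.ofReal (2 * Real.exp (-((Nat.log 2 n : ℝ) + 1)))) atTop (𝓝 0) := by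
  -- `⌊log₂ n⌋ → ∞` (cf. `Literature.Probability.Percolation.TwoArmScalingLimit.tendsto_nat_log_two_atTop`,
  -- whose percolation module is not imported here)
  have h0 : Tendsto (fun n : ℕ => Nat.log 2 n) atTop atTop :=
    tendsto_atTop_atTop.2 fun b => ⟨2 ^ b, fun n hn => Nat.le_log_of_pow_le (by norm_num) hn⟩
  have h1 : Tendsto (fun n : ℕ => (Nat.log 2 n : ℝ) + 1) atTop atTop :=
    tendsto_atTop_add_const_right _ 1 (tendsto_natCast_atTop_atTop.comp h0)
  have h2 : Tendsto (fun n : ℕ => 2 * Real.exp (-((Nat.log 2 n : ℝ) + 1))) atTop (𝓝 0) := by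
    simpa using (Real.tendsto_exp_neg_atTop_nhds_zero.comp h1).const_mul 2
  rw [← ENNReal.ofReal_zero]
  exact ENNReal.tendsto_ofReal h2

/-! ### Counting to probability -/

/-- A counting bound `#S ≤ 2^{#E} · e` is a probability bound `Pr_{G(n,1/2)}[S] ≤ e`. [folklore] -/
theorem erdosRenyiHalf_le_ofReal {n : ℕ} (S : Set (EdgeVec n)) [DecidablePred (· ∈ S)] {e : ℝ} (he : 0 ≤ e)
    (h : (#(univ.filter fun x : EdgeVec n => x ∈ S) : ℝ) ≤ 2 ^ Fintype.card (⊤ : SimpleGraph (Fin n)).edgeSet * e) :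
    (erdosRenyiHalf n).toOuterMeasure S ≤ ENNReal.ofReal e := by
  rw [erdosRenyiHalf_toOuterMeasure_eq_card_div]
  have hM : (Fintype.card (EdgeVec n) : ℝ) = 2 ^ Fintype.card (⊤ : SimpleGraph (Fin n)).edgeSet := by
    rw [Fintype.card_fun, Fintype.card_bool]; push_cast; ring
  have hM0 : (Fintype.card (EdgeVec n) : ℝ≥0∞) ≠ 0 := by
    exact_mod_cast (Fintype.card_pos (α := EdgeVec n)).ne'
  have hMtop : (Fintype.card (EdgeVec n) : ℝ≥0∞) ≠ ⊤ := ENNReal.natCast_ne_top _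
  rw [ENNReal.div_le_iff hM0 hMtop]
  have hR : (#(univ.filter fun x : EdgeVec n => x ∈ S) : ℝ) ≤ e * (Fintype.card (EdgeVec n) : ℝ) := by
    rw [hM]; linarith
  calc (#(univ.filter fun x : EdgeVec n => x ∈ S) : ℝ≥0∞)
      = ENNReal.ofReal (#(univ.filter fun x : EdgeVec n => x ∈ S) : ℝ) := by rw [ENNReal.ofReal_natCast]
    _ ≤ ENNReal.ofReal (e * (Fintype.card (EdgeVec n) : ℝ)) := ENNReal.ofReal_le_ofReal hR
    _ = ENNReal.ofReal e * (Fintype.card (EdgeVec n) : ℝ≥0∞) := by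
        rw [ENNReal.ofReal_mul he, ENNReal.ofReal_natCast]

/-- Averaging a uniform bound over the planted set: if `Pr_z[plant A z ∈ S] ≤ e` for every `A` of the right
size then `Pr_{G(n,1/2,k)}[S] ≤ e`. [folklore] -/
theorem plantedCliqueDist_le_of_forall {n k : ℕ} (S : Set (EdgeVec n)) (e : ℝ≥0∞)
    (h : ∀ A ∈ kSubsets n k, (erdosRenyiHalf n).toOuterMeasure {x | plant A x ∈ S} ≤ e) :
    (plantedCliqueDist n k).toOuterMeasure S ≤ e := by
  rw [plantedCliqueDist_toOuterMeasure_eq_sum]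
  have hc0 : ((#(kSubsets n k) : ℕ) : ℝ≥0∞) ≠ 0 := by
    exact_mod_cast (card_pos.2 (kSubsets_nonempty n k)).ne'
  have hctop : ((#(kSubsets n k) : ℕ) : ℝ≥0∞) ≠ ⊤ := ENNReal.natCast_ne_top _
  calc ((#(kSubsets n k) : ℕ) : ℝ≥0∞)⁻¹ * ∑ A ∈ kSubsets n k, (erdosRenyiHalf n).toOuterMeasure {x | plant A x ∈ S}
      ≤ ((#(kSubsets n k) : ℕ) : ℝ≥0∞)⁻¹ * ∑ A ∈ kSubsets n k, e := by
        gcongr with A hA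
        exact h A hA
    _ = e := by
        rw [sum_const, nsmul_eq_mul, ← mul_assoc, ENNReal.inv_mul_cancel hc0 hctop, one_mul]

/-! ### The room theorem -/

/-- **The room theorem: a quasi-polynomial MONOTONE strong detector for planted cliques below `√n`.**
For every `δ ∈ (0,1/2)` and `ε > 0` there is a family of circuits over `{∧₂, ∨₂, 0, 1}` on the edges of `Kₙ`
with `size ≤ n^{(2δ+ε) log₂ n}` eventually whose `G(n,1/2)`-acceptance probability plus
planted-`⌈n^{1/2-δ}⌉`-clique rejection probability tends to `0` (guess `t ≈ 2δ log₂ n + 2 log₂ log₂ n` clique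
vertices, verify by counting common neighbours). [folklore] -/
theorem karlinRubin_exists_monotone_detector_quasipoly (δ ε : ℝ) (hδ : 0 < δ) (hδ' : δ < 1 / 2) (hε : 0 < ε) :
    ∃ C : (n : ℕ) → Circuit ((⊤ : SimpleGraph (Fin n)).edgeSet),
      (∀ n, (C n).IsOver monotoneBasis01) ∧
      (∀ᶠ n : ℕ in atTop, ((C n).size : ℝ) ≤ (n : ℝ) ^ ((2 * δ + ε) * Real.logb 2 n)) ∧
      Tendsto (fun n : ℕ => (erdosRenyiHalf n).toOuterMeasure {x | (C n).eval x = true} +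
        (plantedCliqueDist n ⌈(n : ℝ) ^ (1 / 2 - δ)⌉₊).toOuterMeasure {x | (C n).eval x = false})
        atTop (𝓝 0) := by
  classical
  -- the parameters
  let k : ℕ → ℕ := fun n => ⌈(n : ℝ) ^ (1 / 2 - δ)⌉₊
  let L : ℕ → ℕ := fun n => Nat.log 2 n
  let Q : ℕ → ℕ := fun n => 800 * n * (L n + 1) ^ 2 / k n ^ 2 + 1
  let t : ℕ → ℕ := fun n => Nat.log 2 (Q n) + 1
  let θ : ℕ → ℕ := fun n => (n - t n) / 2 ^ t n + k n / 4 + 1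
  -- the family: the detector where `t n ≤ n`, a constant otherwise
  have hconst : ∀ n : ℕ, ∃ C : Circuit ((⊤ : SimpleGraph (Fin n)).edgeSet), C.IsOver monotoneBasis01 ∧
      C.size ≤ 1 ∧ ∀ x, C.eval x = false := fun n => (cktSize_const_mono01 _ false).toCircuit
  let C : (n : ℕ) → Circuit ((⊤ : SimpleGraph (Fin n)).edgeSet) := fun n =>
    if h : t n ≤ n then (exists_detector_circuit n (t n) (θ n) h).choose else (hconst n).choose
  have hCover : ∀ n, (C n).IsOver monotoneBasis01 := by
    intro n
    by_cases h : t n ≤ n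
    · simp only [C, dif_pos h]; exact (exists_detector_circuit n (t n) (θ n) h).choose_spec.1
    · simp only [C, dif_neg h]; exact (hconst n).choose_spec.1
  refine ⟨C, hCover, ?_, ?_⟩
  · -- size
    filter_upwards [eventually_base hδ hδ' hε] with n ⟨hn, hkBig, h6k, hk2, hkSq, hslack⟩
    obtain ⟨⟨-, -, htn⟩, -, -, hsize⟩ :=
      room_derived (δ := δ) (ε := ε) (n := n) (k := k n) (L := L n) (Q := Q n) (t := t n) (θ := θ n)
        rfl rfl rfl rfl hn hkBig h6k hk2 hkSq hslack
    simp only [C, dif_pos htn]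
    refine le_trans ?_ hsize
    exact_mod_cast (exists_detector_circuit n (t n) (θ n) htn).choose_spec.2.1
  · -- errors
    refine tendsto_of_tendsto_of_tendsto_of_le_of_le' tendsto_const_nhds tendsto_ofReal_two_mul_exp_neg
      (Eventually.of_forall fun n => bot_le) ?_
    filter_upwards [eventually_base hδ hδ' hε] with n ⟨hn, hkBig, h6k, hk2, hkSq, hslack⟩
    obtain ⟨⟨htk, hkn, htn⟩, ⟨hμ0, hμθ, hθμ, hnull⟩, ⟨hμ₁0, hτlo, hτhi, hplanted⟩, -⟩ :=
      room_derived (δ := δ) (ε := ε) (n := n) (k := k n) (L := L n) (Q := Q n) (t := t n) (θ := θ n)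
        rfl rfl rfl rfl hn hkBig h6k hk2 hkSq hslack
    have hCn : C n = (exists_detector_circuit n (t n) (θ n) htn).choose := by simp only [C, dif_pos htn]
    have hDe := (exists_detector_circuit n (t n) (θ n) htn).choose_spec.2.2
    rw [← hCn] at hDe
    set e : ℝ := Real.exp (-((L n : ℝ) + 1)) with he
    have he0 : 0 ≤ e := (Real.exp_pos _).le
    -- type I
    have hI : (erdosRenyiHalf n).toOuterMeasure {x | (C n).eval x = true} ≤ ENNReal.ofReal e := by
      refine erdosRenyiHalf_le_ofReal _ he0 ?_
      set μ : ℝ := ((n - t n : ℕ) : ℝ) * (2 : ℝ)⁻¹ ^ t n with hμ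
      have hη0 : 0 ≤ (θ n : ℝ) / μ - 1 := by rw [sub_nonneg, le_div_iff₀ hμ0]; linarith
      have hη2 : (θ n : ℝ) / μ - 1 ≤ 2 := by rw [sub_le_iff_le_add, div_le_iff₀ hμ0]; linarith
      have hθeq : (1 + ((θ n : ℝ) / μ - 1)) * μ ≤ θ n := by
        rw [add_sub_cancel, div_mul_cancel₀ _ hμ0.ne']
      have hcount := card_null_le (n := n) (t n) (θ n) hη0 hη2 hθeq
      rw [← hμ] at hcount
      have hset : (univ.filter fun x : EdgeVec n => x ∈ {x | (C n).eval x = true}) =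
          univ.filter fun x : EdgeVec n => ∃ T ∈ powersetCard (t n) (univ : Finset (Fin n)),
            θ n ≤ #((univ \ T).filter fun u => ∀ e ∈ (univ.filter fun e : (⊤ : SimpleGraph (Fin n)).edgeSet =>
              ∃ w ∈ T, (e : Sym2 (Fin n)) = s(u, w)), x e = true) := by
        ext x
        simp only [mem_filter, mem_univ, true_and, Set.mem_setOf_eq, hDe, decide_eq_true_eq]
      rw [hset]
      refine hcount.trans ?_
      rw [mul_comm ((n.choose (t n) : ℝ)), mul_assoc]
      rw [neg_div] at hnull
      exact mul_le_mul_of_nonneg_left (by rw [mul_comm]; exact hnull) (by positivity)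
    -- type II
    have hII : (plantedCliqueDist n (k n)).toOuterMeasure {x | (C n).eval x = false} ≤ ENNReal.ofReal e := by
      refine plantedCliqueDist_le_of_forall _ _ fun A hA => ?_
      have hAcard : #A = k n := by rw [card_of_mem_kSubsets hA]; exact min_eq_left hkn
      obtain ⟨T₀, hT₀A, hT₀⟩ := exists_subset_card_eq (s := A) (n := t n) (by rw [hAcard]; exact htk)
      refine erdosRenyiHalf_le_ofReal _ he0 ?_
      set μ₁ : ℝ := ((n - k n : ℕ) : ℝ) * (2 : ℝ)⁻¹ ^ t n with hμ₁
      set τ : ℝ := (θ n : ℝ) - ((k n - t n : ℕ) : ℝ) - 1 with hτ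
      have hη0 : 0 ≤ 1 - τ / μ₁ := by rw [sub_nonneg, div_le_one hμ₁0]; exact hτhi
      have hη2 : 1 - τ / μ₁ ≤ 2 := by
        have : -1 ≤ τ / μ₁ := by rw [le_div_iff₀ hμ₁0]; linarith
        linarith
      have hθeq : (θ n : ℝ) - ((#A - t n : ℕ) : ℝ) - 1 ≤ (1 - (1 - τ / μ₁)) * (((n - #A : ℕ) : ℝ) * (2 : ℝ)⁻¹ ^ t n) := by
        rw [hAcard, sub_sub_cancel, div_mul_cancel₀ _ hμ₁0.ne']
      have hcount := card_planted_le A T₀ hT₀A (t n) (θ n) hT₀ hη0 hη2 hθeq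
      rw [hAcard, ← hμ₁] at hcount
      have hset : (univ.filter fun z : EdgeVec n => z ∈ {x | plant A x ∈ {x | (C n).eval x = false}}) =
          univ.filter fun z : EdgeVec n => ¬ ∃ T ∈ powersetCard (t n) (univ : Finset (Fin n)),
            θ n ≤ #((univ \ T).filter fun u => ∀ e ∈ (univ.filter fun e : (⊤ : SimpleGraph (Fin n)).edgeSet =>
              ∃ w ∈ T, (e : Sym2 (Fin n)) = s(u, w)), plant A z e = true) := by
        ext z
        simp only [mem_filter, mem_univ, true_and, Set.mem_setOf_eq, hDe, decide_eq_false_iff_not]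
      rw [hset]
      refine hcount.trans ?_
      rw [neg_div] at hplanted
      exact mul_le_mul_of_nonneg_left hplanted (by positivity)
    calc (erdosRenyiHalf n).toOuterMeasure {x | (C n).eval x = true} +
          (plantedCliqueDist n (k n)).toOuterMeasure {x | (C n).eval x = false}
        ≤ ENNReal.ofReal e + ENNReal.ofReal e := add_le_add hI hII
      _ = ENNReal.ofReal (2 * e) := by rw [← ENNReal.ofReal_add he0 he0]; ring_nf

/-! ### Consequence for `MonotoneSuffices`: any quasi-polynomial general lower bound suffices -/

/-- **`MonotoneSuffices` from ANY quasi-polynomial planted-clique lower bound for circuits.** If for every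
`δ ∈ (0,1/2)` some `η > 0` bounds every strongly detecting `B₂` family from below by `n^{η log₂ n}`
eventually, then `MonotoneSuffices` holds, at `δ` with exponent `a = ⌈3δ/η⌉ + 1`: the budget `s(n)` is then
`≥ n^{η log₂ n}` and the room detector of size `n^{3δ log₂ n}` fits under `(s(n)+n)^a`. This replaces the
exponent `4c` (brute force, `n^{3 log₂ n+5}`) of `karlinRubin_monotoneSuffices_of_quasipolyHard` by one
proportional to `δ/η`. [folklore] -/
theorem karlinRubin_monotoneSuffices_of_quasipolyHard_real
    (H : ∀ δ : ℝ, 0 < δ → δ < 1 / 2 → ∃ η : ℝ, 0 < η ∧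
      ∀ C : (n : ℕ) → Circuit ((⊤ : SimpleGraph (Fin n)).edgeSet),
        (∀ᶠ n : ℕ in atTop, (C n).IsOver B2) →
        Tendsto (fun n : ℕ =>
          (erdosRenyiHalf n).toOuterMeasure {x | (C n).eval x = true} +
            (plantedCliqueDist n ⌈(n : ℝ) ^ (1 / 2 - δ)⌉₊).toOuterMeasure {x | (C n).eval x = false})
          atTop (𝓝 0) →
        ∀ᶠ n : ℕ in atTop, (n : ℝ) ^ (η * Real.logb 2 n) ≤ (C n).size) :
    Summit.PneNP.PneNP.Theses.KarlinRubin.MonotoneSuffices := by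
  intro δ hδ hδ'
  obtain ⟨η, hη, hH⟩ := H δ hδ hδ'
  refine ⟨⌈3 * δ / η⌉₊ + 1, fun s ⟨C, hC, hT⟩ => ?_⟩
  obtain ⟨C', hB', hC', hT'⟩ := karlinRubin_exists_monotone_detector_quasipoly δ δ hδ hδ' hδ
  refine ⟨C', ?_, hT'⟩
  have hhard := hH C (hC.mono fun n h => h.1) hT
  filter_upwards [hC', hC, hhard, eventually_ge_atTop 2] with n hn hCn hh h2
  refine ⟨hB' n, ?_⟩
  set a : ℕ := ⌈3 * δ / η⌉₊ + 1 with ha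
  have hn1 : (1 : ℝ) ≤ n := by exact_mod_cast (show 1 ≤ n by omega)
  have hlog : 0 ≤ Real.logb 2 n := Real.logb_nonneg one_lt_two hn1
  have haη : 3 * δ ≤ a * η := by
    have h1 : 3 * δ / η ≤ (⌈3 * δ / η⌉₊ : ℝ) := Nat.le_ceil _
    have h2 : (a : ℝ) = (⌈3 * δ / η⌉₊ : ℝ) + 1 := by rw [ha]; push_cast; ring
    rw [div_le_iff₀ hη] at h1
    nlinarith
  -- `size C' ≤ n^{3δ log₂ n} ≤ (n^{η log₂ n})^a ≤ (s n)^a ≤ (s n + n)^a`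
  have hs : (n : ℝ) ^ (η * Real.logb 2 n) ≤ s n := hh.trans (by exact_mod_cast hCn.2)
  have hreal : ((C' n).size : ℝ) ≤ ((s n + n) ^ a : ℕ) := by
    calc ((C' n).size : ℝ) ≤ (n : ℝ) ^ ((2 * δ + δ) * Real.logb 2 n) := hn
      _ ≤ (n : ℝ) ^ ((a : ℝ) * (η * Real.logb 2 n)) :=
          Real.rpow_le_rpow_of_exponent_le hn1 (by nlinarith)
      _ = ((n : ℝ) ^ (η * Real.logb 2 n)) ^ a := by
          rw [mul_comm (a : ℝ), Real.rpow_mul_natCast (by positivity)]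
      _ ≤ (s n : ℝ) ^ a := pow_le_pow_left₀ (by positivity) hs a
      _ ≤ ((s n + n : ℕ) : ℝ) ^ a := pow_le_pow_left₀ (by positivity) (by push_cast; linarith) a
      _ = ((s n + n) ^ a : ℕ) := by push_cast; ring
  exact_mod_cast hreal

end Summit.PneNP.PneNP.Theorems

namespace Summit.PneNP.PneNP.Theorems

/-- Registered sub-goal `room_main` of stmt-PneNP-18026: **the room theorem** (quasi-polynomial monotone strong
detector of size `n^{(2δ+ε) log₂ n}` for planted `⌈n^{1/2-δ}⌉`-cliques in `G(n,1/2)`), exported verbatim.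
[folklore] -/
theorem room_main :
    ∀ (δ ε : ℝ), 0 < δ → δ < 1 / 2 → 0 < ε → ∃ C : (n : ℕ) → Literature.Computability.Complexity.Circuit ((⊤ : SimpleGraph (Fin n)).edgeSet), (∀ n, (C n).IsOver Literature.Computability.Complexity.monotoneBasis01) ∧ (∀ᶠ n : ℕ in Filter.atTop, ((C n).size : ℝ) ≤ (n : ℝ) ^ ((2 * δ + ε) * Real.logb 2 n)) ∧ Filter.Tendsto (fun n : ℕ => (Literature.Probability.RandomGraphs.PlantedClique.erdosRenyiHalf n).toOuterMeasure {x | (C n).eval x = true} + (Literature.Probability.RandomGraphs.PlantedClique.plantedCliqueDist n ⌈(n : ℝ) ^ (1 / 2 - δ)⌉₊).toOuterMeasure {x | (C n).eval x = false}) Filter.atTop (nhds 0) :=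
  fun δ ε hδ hδ' hε => karlinRubin_exists_monotone_detector_quasipoly δ ε hδ hδ' hε

end Summit.PneNP.PneNP.Theorems
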